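import Summits.BirchSwinnertonDyer.BirchSwinnertonDyer.Theses.TameQuarticManinParity
import Summits.BirchSwinnertonDyer.BirchSwinnertonDyer.Theorems.TameQuarticManinParityTwistPairAtThree
import HarnessLib

/-!
# Route `TameQuarticManinParity`, LINE 22 (bsd-idea-3 g8), glue G22′ `TprimeIrrManinUnitOfIIIHalf`
# (stmt-BirchSwinnertonDyer-28157) — PROVED BY NAME

Cell `pub/bsd-wall`, D-0145 line `route-BirchSwinnertonDyer-TeichmullerTwistDescent`, seat `bsd-line-ttd-p1` g9,
working the planner-of-record's TQMP LINE 22. BSD is NOT proved by this; Manin's conjecture is not proved by this;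
X22 (`TprimeIrrTwistPartnerOptimalDatum`, stmt-28141), the ČNS half (`TprimeIrrManinUnitOfDegreePrimeToThree`,
24499) and the organ `TprimeIrrManinUnitOfThreeDvdDegree` (24498) stay OPEN here. This file closes ONLY the glue.

## Statement (verbatim the route decl)

`TprimeIrrTwistPartnerOptimalDatum → TprimeIrrManinUnitOfDegreePrimeToThree → [organ 24498 on the rows
ord₃ Δ_min(W) = 3] → TprimeIrrManinUnitOfThreeDvdDegree`.

## Proof

Split the (t′) rows by `ord₃ Δ_min ∈ {3, 9}` (`TwistPairAtThree.padicValInt_eq_three_or_nine_of_subTprime`). A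
Kodaira-III row is the hypothesis. A III* row takes its partner `A` from X22 (type III since the two minimal
discriminant valuations sum to `12`) with its conductor-level lattice-optimal, degree-minimal datum `D'`; `c(D')` is
a `3`-unit by the III hypothesis (`3 ∣ deg D'`) or by the ČNS half (`3 ∤ deg D'`); the landed one-sided Gauss-sum
transport `TwistPairAtThree.tprimeIrr_IIIstar_of_III_partner` carries the unit back to `W`. Pure logic over landed
theorems. Design: theorems only; no definition, no named fact, no `sorry`; axioms `propext`, `Classical.choice`,
`Quot.sound`.
-/

set_option autoImplicit false
-- D-0017: single-problem summit, so `Summit.BirchSwinnertonDyer.BirchSwinnertonDyer.…` repeats a namespace BY DESIGN.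
set_option linter.dupNamespace false

namespace Summit.BirchSwinnertonDyer.BirchSwinnertonDyer.Theorems.TameQuarticManinParity

open Summit.BirchSwinnertonDyer.BirchSwinnertonDyer.Theses.TameQuarticManinParity

/-- **Glue G22′** (stmt-BirchSwinnertonDyer-28157), by name: X22 ∧ ČNS-half ∧ [organ 24498 on the Kodaira-III rows]
⟹ organ 24498 on every irreducible (t′) row — the III* rows borrow their type-III partner's optimal datum and the
one-sided twist transport `TwistPairAtThree.tprimeIrr_IIIstar_of_III_partner`. [cite: Stevens1989, Lemmas (5.2), (5.4)] -/
theorem tprimeIrrManinUnitOfIIIHalf_proof : TprimeIrrManinUnitOfIIIHalf := by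
  unfold TprimeIrrManinUnitOfIIIHalf
  intro hX hCNS hIII W _ _ _ hcm hadd ht hirr D hlat hmin hdeg
  rcases TwistPairAtThree.padicValInt_eq_three_or_nine_of_subTprime W hadd ht with h3 | h9
  · exact hIII W hcm hadd ht hirr h3 D hlat hmin hdeg
  · obtain ⟨A, _, _, _, hsum, hAW, hcmA, haddA, htA, hirrA, hNA, D', hlat', hmin'⟩ := hX W hcm hadd ht hirr D
    have h3A : padicValInt 3 A.minimalDiscriminantInt = 3 := by omega
    have hc' : ¬ (3 : ℤ) ∣ D'.maninConstant := by
      by_cases hdeg' : 3 ∣ D'.modularDegree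
      · exact hIII A hcmA haddA htA hirrA h3A D' hlat' hmin' hdeg'
      · exact hCNS A hcmA haddA htA hirrA D' hlat' hmin' hdeg'
    exact TwistPairAtThree.tprimeIrr_IIIstar_of_III_partner W hcm hadd ht hirr h9 D hlat hmin hdeg A h3A hAW
      D' (dvd_of_eq hNA) hc'

end Summit.BirchSwinnertonDyer.BirchSwinnertonDyer.Theorems.TameQuarticManinParity
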